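import Summits.QuantumFields.BalabanUV.Beta.D1BFx.GhostLegReflection
import Summits.QuantumFields.BalabanUV.Beta.D1BFx.GhostKernelSandwich

/-!
# `BalabanUV.Beta.D1BFx.GhostStencilReflection` — road «BF-x» for binder row D1, sub-leaf A4-leg-PARITY-gh (part 2): THE T6 STENCIL /
# TABLE INVERSION LAWS — the current's law HOLDS, the head-contact's law holds ONLY WITH A DIFFERENT OFFSET, and NO leg relabelling
# whatsoever transports T6 v1's current and head contact by a common inversion-type bond map (kernel-checked no-go); the reversal-
# symmetric same-bond contact that does

HONEST DEPENDENCY (page 1, mandatory): continuum YM on T⁴ ⇐ BetaPertH ∧ nine spine estimates (0/9 proved); BetaPertH ⇐ (D1) ∧ (D4) ∧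
CAP+tail; G-an2-4 gates asym, D1 and NE2/3/4.  HONEST FRAMING (cell contract, verbatim): «discharging `BetaPertH` makes Bałaban's UV
stability UNCONDITIONAL — a real constructive-QFT result; it is NOT the continuum limit and NOT the Clay problem.»  THIS FILE DISCHARGES
NOTHING of D1 / BetaPertH: [folklore] finite bookkeeping about the road's OWN typed objects (T6 `GhostStencil.ghCur/ghCnt`, part 1's
`GhostLegReflection.invLeg`, an5's `KernelReflection.refK`) and ONE new object (`ghX`, a definition asserting nothing); 0 binders of the
hR root are touched; no `def … : Prop`, no citation, no printed statement as hypothesis.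
ABSOLUTE RULE (cell charter, verbatim): «No internally-minted statement may enter as a cited fact. Every hypothesis is either
kernel-proved in this package or a verbatim quotation of a PUBLISHED theorem with page reference. The manuscript(s) under audit are NOT
citable for their own disputed steps — they are the thing under adjudication; programme-internal (2001/route/tribunal) claims are never
citable.»

WHY.  Gen 2's parity END `FineHessianReflection.bondSecondMoment_Pgh_eq_avgM2_of_refl` (node R5, (T1-avg) for leaf-04's ghost kernel
`Pgh`) asks, for ONE leg relabelling `Φ`, ONE offset family `c` and signs `σ κ′ σ λ′ = 1`, the sockets
`hSr : Sgh n cK cQ κ′ (c κ′ − u) = σ κ′ • refK Φ (Sgh n cK cQ κ′ u)` and `hTr : ghTab cW κ′ (c κ′ − u) = refK Φ (ghTab cW κ′ u)` — the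
SAME bond map `u ↦ c κ′ − u` for the first-order stencil and the second-order table, as an5's `hess_refl` must (both are derivatives of
one operator family at the same bond).  Part 1 discharged `hAr` for every block-compatible reflection.  Here, for the point inversion
`x ↦ (n−1)·𝟙 − x` (`GhostLegReflection.invLeg n`):
* §1 [folklore] `refK (invLeg n) K x z = K ((n−1)·𝟙 − x) ((n−1)·𝟙 − z)`; `refK` is linear.
* §2 [folklore] **THE CURRENT'S LAW HOLDS**: `ghCur κ′ (cInv n κ′ − u) = (−1) • refK (invLeg n) (ghCur κ′ u)`, `cInv n κ′ = (n−1)·𝟙 − e_κ′`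
  (a bond goes to the REVERSED bond: sign `−1` in every direction, so `σ κ′ σ λ′ = 1` as the END wants).
* §3 [folklore] **THE HEAD CONTACT'S LAW HOLDS ONLY WITH THE OFFSET `(n−1)·𝟙 − 2e_κ′`** (`ghCnt_pointInversion`; the head of a bond is the
  TAIL of the reversed bond), and FAILS with the current's offset (`ghCnt_pointInversion_ne`, witness entry).  **NO-GO** (`no_common_law`):
  for EVERY `Φ : LegMap 4 Unit`, every direction `κ′`, every offset `c` and sign `σ`, the two laws `∀ u, ghCur κ′ (c − u) = σ • refK Φ (ghCur κ′ u)`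
  and `∀ u, ghCnt κ′ (c − u) = refK Φ (ghCnt κ′ u)` are jointly contradictory (three evaluations of the hypotheses; no geometry of `Φ` used).
  COROLLARY (`no_refl_sockets_of_cQ_zero`): at `cQ = 0`, `cK ≠ 0`, `cW ≠ 0` the sockets `hSr ∧ hTr` of the END have NO instantiation — the
  END is vacuous for T6 v1's ghost-kinetic data.  DIAGNOSIS (prose, for the owner's CHECK-N0 — nothing asserted in Lean): T6 v1's `ghCnt`
  transcribes an3's `GhostTable.vertex₂ = E_{x+e,x+e} ⊗ AᵀA`, the same-bond second jet of the LINEAR bond transporter `1 + tA` (`GhostTable` §1);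
  an3's own §6 (`lapFamilyJ_expand`) records that the second jet `B` of the transporter changes exactly this contact: for `exp` (`B = A²/2`,
  `Aᵀ = −A`) the `t²`-coefficient is `vertex₂(A) + vertex₁(B) = −(E_{u,u+e} + E_{u+e,u}) ⊗ A²/2` — the REVERSAL-SYMMETRIC cross contact, whose
  stripped kernel is §4's `ghX`.  Whether Bałaban's ghost action carries the `exp` contact is the owner's identification, NOT made here.
* §4 [our object] `ghX κ′ u x z := [x = u+e_κ′ ∧ z = u] + [x = u ∧ z = u+e_κ′]` with sockets (symmetry, fine-translation covariance,
  `BiLoc … u u e^{δ} δ`) and **its law with the CURRENT'S offset**: `ghX κ′ (cInv n κ′ − u) = refK (invLeg n) (ghX κ′ u)` — so for the pair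
  `(ghCur, ghX)` the END's `hSr`/`hTr` shapes ARE jointly instantiated by `(invLeg n, cInv n, σ ≡ −1)` at `cQ = 0`.
NOT HERE (honest): the `Q′(U)`-jet sector `qAnti` (`cQ ≠ 0`): T6 v1 roots an1's axial contour at the block's BASE CORNER `n•y`, and no
block-compatible reflection carries base-rooted contours to base-rooted contours (an5 X-an5-17, β-lead RULING (R32-1): centre root, odd side —
`AveragingContoursRooted`), so `qAnti`'s law is expected to fail as typed; its kernel witness / the re-rooted `qJetAt ρ` are a separate part.
Nothing about Ward rows; nothing printed.  Unit `b2b-balaban-beta-d1-formalise-leaf-01` (gen 3).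
-/

noncomputable section

namespace Summit.QuantumFields.BalabanUV.Beta.D1BFx.GhostStencilReflection

open Finset
open scoped BigOperators
open Literature.MathematicalPhysics.QuantumFieldTheory.Balaban1983to89
open Literature.MathematicalPhysics.QuantumFieldTheory.Balaban1983to89.Beta
open B12Sec2to5 (l1 l1_nonneg)
open ExpKernelCalculus (Site MKer BiLoc shiftK)
open AffineAveraging (unitVec unitVec_apply)
open KernelReflection (LegMap refK refK_apply)
open Summit.QuantumFields.BalabanUV.Beta.D1BFx.GhostStencil (ghCur ghCur_apply ghCnt ghCnt_apply Sgh Sgh_apply qAnti unitVec_ne_zero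
  l1_unitVec l1_zero)
open Summit.QuantumFields.BalabanUV.Beta.D1BFx.GhostKernelSandwich (ghTab ghTab_apply)
open Summit.QuantumFields.BalabanUV.Beta.D1BFx.GhostLegReflection (invLeg invLeg_r_apply invLeg_s)

/-! ## §1 The point inversion on kernels; linearity of `refK` -/

/-- [our object] The inversion centre in road units: the constant vector `(n − 1)·𝟙`. -/
def ctrVec (n : ℕ) : Site 4 := fun _ => (n : ℤ) - 1

/-- [our object] **THE CURRENT'S OFFSET**: `cInv n κ′ := (n−1)·𝟙 − e_κ′` — the point inversion sends the bond `⟨u, u + e_κ′⟩` to the REVERSED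
bond based at `cInv n κ′ − u`. -/
def cInv (n : ℕ) (κ' : Fin 4) : Site 4 := ctrVec n - unitVec κ'

variable (n : ℕ) [NeZero n]

/-- [folklore] The bijection of `invLeg n` is `x ↦ ctrVec n − x`. -/
theorem invLeg_r_eq (x : Site 4) (a : Unit) : (invLeg n).r a x = ctrVec n - x := by
  funext μ
  rw [invLeg_r_apply, Pi.sub_apply]
  rfl

/-- [folklore] **`refK (invLeg n) K x z = K ((n−1)·𝟙 − x) ((n−1)·𝟙 − z)`** (the `Unit` signs are `+1`). -/
theorem refK_invLeg_apply (K : MKer 4 Unit) (x z : Site 4) (a b : Unit) :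
    refK (invLeg n) K x z a b = K (ctrVec n - x) (ctrVec n - z) a b := by
  simp only [refK_apply, invLeg_s, invLeg_r_eq, one_mul]

variable {F : Type*}

/-- [folklore] `refK` commutes with scalars. -/
theorem refK_smul (Φ : LegMap 4 F) (c : ℝ) (K : MKer 4 F) : refK Φ (c • K) = c • refK Φ K := by
  funext x z a b
  simp only [refK_apply, Pi.smul_apply, smul_eq_mul]
  ring

/-- [folklore] `refK` is additive. -/
theorem refK_add (Φ : LegMap 4 F) (K L : MKer 4 F) : refK Φ (K + L) = refK Φ K + refK Φ L := by
  funext x z a b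
  simp only [refK_apply, Pi.add_apply]
  ring

/-- [folklore] For the `Unit` fibre the signs cancel: `refK Φ K x z a b = K (Φ.r a x) (Φ.r b z) a b`. -/
theorem refK_unit_apply (Φ : LegMap 4 Unit) (K : MKer 4 Unit) (x z : Site 4) (a b : Unit) :
    refK Φ K x z a b = K (Φ.r a x) (Φ.r b z) a b := by
  rw [refK_apply, Subsingleton.elim b a, Φ.s_mul_s a, one_mul]

/-- [folklore] Inversion about `t`: `t − x = w ↔ x = t − w`. -/
theorem sub_eq_iff_eq_sub' (t x w : Site 4) : t - x = w ↔ x = t - w := by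
  constructor
  · rintro rfl; abel
  · rintro rfl; abel

/-- [folklore] `c + e_κ′ ≠ c`. -/
theorem add_unitVec_ne_self (c : Site 4) (κ' : Fin 4) : c + unitVec κ' ≠ c := fun h =>
  unitVec_ne_zero κ' (by simpa using h)

/-- [folklore] `c ≠ c + e_κ′`. -/
theorem self_ne_add_unitVec (c : Site 4) (κ' : Fin 4) : c ≠ c + unitVec κ' := fun h =>
  add_unitVec_ne_self c κ' h.symm

/-- [folklore] `c + e_κ′ ≠ c − e_κ′`. -/
theorem add_unitVec_ne_sub_unitVec (c : Site 4) (κ' : Fin 4) : c + unitVec κ' ≠ c - unitVec κ' := by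
  intro h
  have h' := congr_fun h κ'
  simp only [Pi.add_apply, Pi.sub_apply, unitVec_apply, if_true] at h'
  omega

/-! ## §2 The current's law under the point inversion -/

variable (κ' : Fin 4) (u : Site 4)

omit [NeZero n] in
/-- [folklore] Offset bookkeeping: `cInv n κ′ − u + e_κ′ = ctrVec n − u`. -/
theorem cInv_sub_add : cInv n κ' - u + unitVec κ' = ctrVec n - u := by
  unfold cInv; abel

omit [NeZero n] in
/-- [folklore] Offset bookkeeping: `ctrVec n − (u + e_κ′) = cInv n κ′ − u`. -/
theorem ctrVec_sub_add : ctrVec n - (u + unitVec κ') = cInv n κ' - u := by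
  unfold cInv; abel

/-- [folklore] **THE CURRENT'S INVERSION LAW**, unsigned form: `refK (invLeg n) (ghCur κ′ u) = −ghCur κ′ (cInv n κ′ − u)` — the image of the
current on `⟨u, u+e_κ′⟩` is MINUS the current on the reversed image bond. -/
theorem refK_invLeg_ghCur : refK (invLeg n) (ghCur κ' u) = -ghCur κ' (cInv n κ' - u) := by
  funext x z a b
  rw [Pi.neg_apply, Pi.neg_apply, Pi.neg_apply, Pi.neg_apply, refK_invLeg_apply, ghCur_apply, ghCur_apply]
  simp only [sub_eq_iff_eq_sub', ctrVec_sub_add, cInv_sub_add]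
  rw [← cInv_sub_add n κ' u]
  ring

/-- [folklore] **THE `hSr`-SHAPE FOR THE CURRENT**: `ghCur κ′ (cInv n κ′ − u) = (−1) • refK (invLeg n) (ghCur κ′ u)` — the socket of
`FineHessianReflection.bondSecondMoment_Pgh_eq_avgM2_of_refl` for the ghost-kinetic first jet, sign `σ ≡ −1` (`σ κ′ σ λ′ = 1`). -/
theorem ghCur_pointInversion : ghCur κ' (cInv n κ' - u) = (-1 : ℝ) • refK (invLeg n) (ghCur κ' u) := by
  rw [refK_invLeg_ghCur, smul_neg, neg_smul, one_smul, neg_neg]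

/-- [folklore] The same for the weighted kinetic stencil `Sgh n cK 0` (no `Q′(U)`-jet): `hSr` at `cQ = 0`. -/
theorem Sgh_zero_pointInversion (cK : ℝ) :
    Sgh n cK 0 κ' (cInv n κ' - u) = (-1 : ℝ) • refK (invLeg n) (Sgh n cK 0 κ' u) := by
  have hS : ∀ v, Sgh n cK 0 κ' v = cK • ghCur κ' v := fun v => by
    funext x z a b
    rw [Sgh_apply, Pi.smul_apply, Pi.smul_apply, Pi.smul_apply, Pi.smul_apply, smul_eq_mul, zero_mul, add_zero]
  rw [hS, hS, refK_smul, ghCur_pointInversion, smul_comm]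

/-! ## §3 The head contact: right law with the wrong offset; the no-go -/

omit [NeZero n] in
/-- [folklore] Offset bookkeeping: `ctrVec n − 2•e_κ′ − u + e_κ′ = ctrVec n − (u + e_κ′)`. -/
theorem ctrVec_sub_two_add : ctrVec n - (2 : ℤ) • unitVec κ' - u + unitVec κ' = ctrVec n - (u + unitVec κ') := by
  rw [two_smul]; abel

/-- [folklore] **THE HEAD CONTACT TRANSFORMS WITH THE OFFSET `(n−1)·𝟙 − 2e_κ′`** (NOT the current's `cInv n κ′ = (n−1)·𝟙 − e_κ′`):
`ghCnt κ′ (ctrVec n − 2•e_κ′ − u) = refK (invLeg n) (ghCnt κ′ u)` — the head `u + e_κ′` of the bond is the TAIL of its reversed image. -/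
theorem ghCnt_pointInversion : ghCnt κ' (ctrVec n - (2 : ℤ) • unitVec κ' - u) = refK (invLeg n) (ghCnt κ' u) := by
  funext x z a b
  rw [refK_invLeg_apply, ghCnt_apply, ghCnt_apply]
  simp only [sub_eq_iff_eq_sub', ctrVec_sub_two_add]

/-- [folklore] **… AND NOT WITH THE CURRENT'S OFFSET**: `ghCnt κ′ (cInv n κ′ − u) ≠ refK (invLeg n) (ghCnt κ′ u)` (witness entry
`x = z = ctrVec n − (u + e_κ′)`: left side `0`, right side `1`). -/
theorem ghCnt_pointInversion_ne : ghCnt κ' (cInv n κ' - u) ≠ refK (invLeg n) (ghCnt κ' u) := by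
  intro h
  have hx := congr_fun (congr_fun (congr_fun (congr_fun h (ctrVec n - (u + unitVec κ'))) (ctrVec n - (u + unitVec κ'))) ()) ()
  rw [refK_invLeg_apply, ghCnt_apply, ghCnt_apply, sub_sub_cancel, cInv_sub_add] at hx
  have hne : ¬(ctrVec n - (u + unitVec κ') = ctrVec n - u ∧ ctrVec n - (u + unitVec κ') = ctrVec n - u) := by
    rintro ⟨h1, -⟩
    exact unitVec_ne_zero κ' (by simpa using h1)
  rw [if_neg hne, if_pos (show u + unitVec κ' = u + unitVec κ' ∧ u + unitVec κ' = u + unitVec κ' from ⟨rfl, rfl⟩)] at hx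
  exact zero_ne_one hx

/-- [folklore] **NO-GO: NO LEG RELABELLING TRANSPORTS T6 v1's CURRENT AND HEAD CONTACT BY A COMMON INVERSION-TYPE BOND MAP.**  For every
`Φ : LegMap 4 Unit`, direction `κ′`, offset `c` and sign `σ`, the laws `∀ u, ghCur κ′ (c − u) = σ • refK Φ (ghCur κ′ u)` and
`∀ u, ghCnt κ′ (c − u) = refK Φ (ghCnt κ′ u)` are contradictory.  Proof: three evaluations — the current's law at `u = 0` forces
`σ = ±1` and pins `Φ⁻¹` on `{0, e_κ′}`; `σ = 1` contradicts the current's law at `u = e_κ′`; `σ = −1` contradicts the contact's law at `u = 0`. -/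
theorem no_common_law (Φ : LegMap 4 Unit) (κ' : Fin 4) (c : Site 4) (σ : ℝ)
    (hCur : ∀ u : Site 4, ghCur κ' (c - u) = σ • refK Φ (ghCur κ' u))
    (hCnt : ∀ u : Site 4, ghCnt κ' (c - u) = refK Φ (ghCnt κ' u)) : False := by
  obtain ⟨R, hrR⟩ : ∃ R : Site 4 → Site 4, ∀ x, Φ.r () (R x) = x := ⟨(Φ.r ()).symm, fun x => Equiv.apply_symm_apply _ _⟩
  have he : (unitVec κ' : Site 4) ≠ 0 := unitVec_ne_zero κ'
  -- pointwise evaluation of the two laws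
  have evCur : ∀ u x z : Site 4, ghCur κ' (c - u) x z () () = σ * ghCur κ' u (Φ.r () x) (Φ.r () z) () () := fun u x z => by
    have h := congr_fun (congr_fun (congr_fun (congr_fun (hCur u) x) z) ()) ()
    rwa [Pi.smul_apply, Pi.smul_apply, Pi.smul_apply, Pi.smul_apply, smul_eq_mul, refK_unit_apply] at h
  have evCnt : ∀ u x z : Site 4, ghCnt κ' (c - u) x z () () = ghCnt κ' u (Φ.r () x) (Φ.r () z) () () := fun u x z => by
    have h := congr_fun (congr_fun (congr_fun (congr_fun (hCnt u) x) z) ()) ()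
    rwa [refK_unit_apply] at h
  -- evaluation 1: the current's law at `u = 0`, entry `(R e, R 0)`
  have h1 := evCur 0 (R (unitVec κ')) (R 0)
  rw [hrR, hrR, ghCur_apply, ghCur_apply, sub_zero, zero_add,
    if_pos (show unitVec κ' = unitVec κ' ∧ (0 : Site 4) = 0 from ⟨rfl, rfl⟩),
    if_neg (fun h : unitVec κ' = 0 ∧ (0 : Site 4) = unitVec κ' => he h.1), sub_zero, mul_one] at h1
  -- h1 : [R e = c + e ∧ R 0 = c] − [R e = c ∧ R 0 = c + e] = σ
  by_cases hA : R (unitVec κ') = c + unitVec κ' ∧ R 0 = c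
  · -- σ = 1; the current's law at `u = e`, entry `(R (e + e), R e)`, reads `0 = 1`
    have hB : ¬(R (unitVec κ') = c ∧ R 0 = c + unitVec κ') := fun hB =>
      self_ne_add_unitVec c κ' (hA.2.symm.trans hB.2)
    rw [if_pos hA, if_neg hB, sub_zero] at h1
    have h2 := evCur (unitVec κ') (R (unitVec κ' + unitVec κ')) (R (unitVec κ'))
    rw [hrR, hrR, ghCur_apply, ghCur_apply,
      if_pos (show unitVec κ' + unitVec κ' = unitVec κ' + unitVec κ' ∧ unitVec κ' = unitVec κ' from ⟨rfl, rfl⟩),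
      if_neg (fun h : unitVec κ' + unitVec κ' = unitVec κ' ∧ unitVec κ' = unitVec κ' + unitVec κ' =>
        add_unitVec_ne_self (unitVec κ') κ' h.1), sub_zero, mul_one, ← h1] at h2
    have hc1 : ¬(R (unitVec κ' + unitVec κ') = c - unitVec κ' + unitVec κ' ∧ R (unitVec κ') = c - unitVec κ') := fun h =>
      add_unitVec_ne_sub_unitVec c κ' (hA.1.symm.trans h.2)
    have hc2 : ¬(R (unitVec κ' + unitVec κ') = c - unitVec κ' ∧ R (unitVec κ') = c - unitVec κ' + unitVec κ') := fun h =>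
      add_unitVec_ne_self c κ' (hA.1.symm.trans (h.2.trans (sub_add_cancel c (unitVec κ'))))
    rw [if_neg hc1, if_neg hc2, sub_zero] at h2
    exact zero_ne_one h2
  · by_cases hB : R (unitVec κ') = c ∧ R 0 = c + unitVec κ'
    · -- σ = −1; the contact's law at `u = 0`, entry `(R e, R e)`, reads `0 = 1`
      have h3 := evCnt 0 (R (unitVec κ')) (R (unitVec κ'))
      rw [hrR, ghCnt_apply, ghCnt_apply, sub_zero, zero_add, hB.1,
        if_pos (show unitVec κ' = unitVec κ' ∧ unitVec κ' = unitVec κ' from ⟨rfl, rfl⟩),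
        if_neg (fun h : c = c + unitVec κ' ∧ c = c + unitVec κ' => self_ne_add_unitVec c κ' h.1)] at h3
      exact zero_ne_one h3
    · -- σ = 0; the current's law at `u = 0`, entry `(c + e, c)`, reads `1 = 0`
      rw [if_neg hA, if_neg hB, sub_zero] at h1
      have h4 := evCur 0 (c + unitVec κ') c
      rw [← h1, zero_mul, ghCur_apply, sub_zero, if_pos (show c + unitVec κ' = c + unitVec κ' ∧ c = c from ⟨rfl, rfl⟩),
        if_neg (fun h : c + unitVec κ' = c ∧ c = c + unitVec κ' => add_unitVec_ne_self c κ' h.1)] at h4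
      norm_num at h4

omit [NeZero n] in
/-- [folklore] **COROLLARY AT THE END's LEVEL (`cQ = 0`)**: for T6 v1's ghost-kinetic data with `cK ≠ 0`, `cW ≠ 0` and no `Q′(U)`-jet, the
sockets `hSr ∧ hTr` of `FineHessianReflection.bondSecondMoment_Pgh_eq_avgM2_of_refl` have NO instantiation `(Φ, c, σ)` whatsoever. -/
theorem no_refl_sockets_of_cQ_zero {cK cW : ℝ} (hK : cK ≠ 0) (hW : cW ≠ 0) (Φ : LegMap 4 Unit) (c : Fin 4 → Site 4)
    (σ : Fin 4 → ℝ) (hSr : ∀ κ' u, Sgh n cK 0 κ' (c κ' - u) = σ κ' • refK Φ (Sgh n cK 0 κ' u))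
    (hTr : ∀ κ' u, ghTab cW κ' (c κ' - u) = refK Φ (ghTab cW κ' u)) : False := by
  have hS : ∀ κ' v, Sgh n cK 0 κ' v = cK • ghCur κ' v := fun κ' v => by
    funext x z a b
    rw [Sgh_apply, Pi.smul_apply, Pi.smul_apply, Pi.smul_apply, Pi.smul_apply, smul_eq_mul, zero_mul, add_zero]
  refine no_common_law Φ 0 (c 0) (σ 0) (fun u => ?_) (fun u => ?_)
  · have h := hSr 0 u
    rw [hS, hS, refK_smul, smul_comm] at h
    exact smul_right_injective _ hK h
  · have h := hTr 0 u
    rw [ghTab_apply, ghTab_apply, refK_smul] at h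
    exact smul_right_injective _ hW h

/-! ## §4 The reversal-symmetric same-bond contact and its law with the current's offset -/

/-- [our object] **THE REVERSAL-SYMMETRIC SAME-BOND CONTACT** `ghX κ′ u x z := [x = u + e_κ′ ∧ z = u] + [x = u ∧ z = u + e_κ′]` — the
colour-stripped kernel of `E_{u,u+e} + E_{u+e,u}` (the shape of the `exp`-transporter's same-bond second jet in an3's `GhostTable` §6,
colour weight `−A²/2` EXTERNAL).  A definition; asserts nothing; NOT claimed to be Bałaban's (owner's CHECK-N0). -/
def ghX (κ' : Fin 4) (u : Site 4) : MKer 4 Unit := fun x z _ _ =>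
  (if x = u + unitVec κ' ∧ z = u then (1 : ℝ) else 0) + (if x = u ∧ z = u + unitVec κ' then (1 : ℝ) else 0)

/-- [our object] Unfolding `ghX`. -/
theorem ghX_apply (x z : Site 4) (a b : Unit) : ghX κ' u x z a b =
    (if x = u + unitVec κ' ∧ z = u then (1 : ℝ) else 0) + (if x = u ∧ z = u + unitVec κ' then (1 : ℝ) else 0) := rfl

/-- [folklore] `ghX` is symmetric. -/
theorem ghX_symm (x z : Site 4) (a b : Unit) : ghX κ' u z x b a = ghX κ' u x z a b := by
  simp only [ghX_apply]
  rw [if_congr (and_comm (a := z = u + unitVec κ') (b := x = u)) (rfl : (1 : ℝ) = 1) (rfl : (0 : ℝ) = 0),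
    if_congr (and_comm (a := z = u) (b := x = u + unitVec κ')) (rfl : (1 : ℝ) = 1) (rfl : (0 : ℝ) = 0)]
  ring

/-- [folklore] Fine-translation covariance: `ghX κ′ (u + v) = shiftK (−v) (ghX κ′ u)`. -/
theorem ghX_translate (v : Site 4) : ghX κ' (u + v) = shiftK (-v) (ghX κ' u) := by
  funext x z a b
  show ghX κ' (u + v) x z a b = ghX κ' u (x + -v) (z + -v) a b
  simp only [ghX_apply, ← sub_eq_add_neg, sub_eq_iff_eq_add, add_right_comm u v (unitVec κ')]

/-- [folklore] LOCALISATION SOCKET: `BiLoc (ghX κ′ u) u u e^{δ} δ` (every real `δ`; the weight is `1` on the support). -/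
theorem biLoc_ghX (δ : ℝ) : BiLoc (ghX κ' u) u u (Real.exp δ) δ := by
  intro x z a b
  simp only [ghX_apply]
  by_cases h1 : x = u + unitVec κ' ∧ z = u
  · obtain ⟨hx, hz⟩ := h1
    have h2 : ¬(x = u ∧ z = u + unitVec κ') := fun h =>
      unitVec_ne_zero κ' (add_left_cancel (show u + unitVec κ' = u + 0 by rw [add_zero, ← hx]; exact h.1))
    rw [if_pos ⟨hx, hz⟩, if_neg h2, add_zero, abs_one, hx, hz, add_sub_cancel_left, sub_self, l1_unitVec, l1_zero, add_zero,
      mul_one, ← Real.exp_add, add_neg_cancel, Real.exp_zero]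
  · by_cases h2 : x = u ∧ z = u + unitVec κ'
    · obtain ⟨hx, hz⟩ := h2
      rw [if_neg h1, if_pos ⟨hx, hz⟩, zero_add, abs_one, hx, hz, sub_self, add_sub_cancel_left, l1_unitVec, l1_zero,
        zero_add, mul_one, ← Real.exp_add, add_neg_cancel, Real.exp_zero]
    · rw [if_neg h1, if_neg h2, add_zero, abs_zero]; positivity

/-- [folklore] **THE SYMMETRIC CONTACT'S LAW WITH THE CURRENT'S OFFSET**: `ghX κ′ (cInv n κ′ − u) = refK (invLeg n) (ghX κ′ u)` — so the pair
`(ghCur, ghX)` IS transported by the common bond map `u ↦ cInv n κ′ − u` (signs `−1` / `(−1)·(−1) = +1`), the shape `hSr`/`hTr` of the END. -/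
theorem ghX_pointInversion : ghX κ' (cInv n κ' - u) = refK (invLeg n) (ghX κ' u) := by
  funext x z a b
  rw [refK_invLeg_apply, ghX_apply, ghX_apply]
  simp only [sub_eq_iff_eq_sub', ctrVec_sub_add, cInv_sub_add]
  rw [← cInv_sub_add n κ' u]
  ring

/-- [folklore] … with an external weight: `(cW • ghX κ′) (cInv n κ′ − u) = refK (invLeg n) (cW • ghX κ′ u)` — the `hTr`-shape for the
one-bond table `fun κ′ u ↦ cW • ghX κ′ u` (to be fed through `FineHessianReflection.diagExt_refl`). -/
theorem smul_ghX_pointInversion (cW : ℝ) : cW • ghX κ' (cInv n κ' - u) = refK (invLeg n) (cW • ghX κ' u) := by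
  rw [refK_smul, ghX_pointInversion]

end Summit.QuantumFields.BalabanUV.Beta.D1BFx.GhostStencilReflection

end
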